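import Summits.QuantumFields.YangMills.Theorems.UnitScaleTiltProp7CovMeanTowerOnto
import Summits.QuantumFields.YangMills.Theorems.UnitScaleTiltProp7SymAvgTwSGaugeDir
import Summits.QuantumFields.YangMills.Theorems.UnitScaleTiltProp7QTwSScalarSectorRegPr
import Summits.QuantumFields.YangMills.Theorems.UnitScaleTiltProp7SymAvgTwSymBridge
import Summits.QuantumFields.YangMills.Theorems.UnitScaleTiltProp7SymFrameBound
import Summits.QuantumFields.YangMills.Theorems.UnitScaleTiltProp7SymAvgRelDiffT3
import Summits.QuantumFields.YangMills.Theorems.UnitScaleTiltProp7QSymCovCandidateOfRegPr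
import Summits.QuantumFields.YangMills.Theorems.UnitScaleTiltProp7SectET3CurvedPropagatorsT3
import HarnessLib

/-!
# Route `UnitScaleTilt`, crux «MinimiserStabilityRegPr» (stmt-QuantumFields-19200, stub EX), route (α), node N06(d = 3) — (N) «`Q_k(U₀)` onto», STEP 2:
# **PRINT'S AVERAGING OPERATOR `Q(U₀) = QTwS U₀` (hence `Q_k(U₀) = η • toL2B ∘ QTwS ∘ toL2⁻¹`) IS ONTO AT EVERY PRINTED-REGULAR BACKGROUND** — the `onto` half of the EX display's
# class row `hN06` ∕ `PosOnto …(Δ_π) U₀` ([Balaban1985BackgroundPropagators] (3.19) p. 393 «Q′ onto»; [Balaban1985Variational] (45) p. 285 `QH = I`)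

Cell `ym3-torus` (HUMAN RULING D-0037, YM ladder rung R3 — YM₃ on T³, NOT d = 4, NOT Clay; YM gap NOT proved), width seat `ym3-torus-px16` (gen 2; LOCATE `LOCATE-QK-ONTO-px16g2.md`,
19200 evidence #48; EX knit namer ★w2-19200 g6 19:26:38Z §2 (N)).  THEOREMS ONLY (0 `def`, 0 `sorry`); `--supports stmt-QuantumFields-19200 --as helper`; count-neutral; an ASSEMBLY BY
NAME of landed bricks + STEP 1 (✓`Prop7CovMeanTowerOnto`); NO claim on the crux, the stub, d = 4 or the gap.

THE ROUTE (the symmetric-frame twin of ✓`Prop7QTwRightInverseOfRegPr.exists_rightInv_QTw_of_regPr`, with the gauge lift read through the averaging sequence instead of the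
covariantly-constant extension).  For `X` a coarse one-form put `A := H X + D_{U₀}N`, where `H` is M12's right inverse of the STRAIGHT symmetric average (✓`exists_rightInv_QSym_of_regPr`:
`QSym U₀ (HX) = X`) and `N` is a fine gauge parameter whose covariant block Ad-averaging sequence ends, at level `K − n`, at the linearised-frame datum `y ↦ r_y(HX)` (STEP 1
✓`exists_seed_of_covMeanTower`; `r_y = D(frameTwS U₀ · y)(0)`).  Then by the bridge ✓`Prop7SymAvgTwSymBridge.QTwS_apply_eq` (`QTwS = QSym − D_{Ū₀}∘r`, rows `hG` ✓`hasFDerivAt_rel_of_regPr`,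
`hr` ✓`hasFDerivAt_frameTwS_of_regPr`) and the gauge-direction identity ✓`Prop7SymAvgTwSGaugeDir.QTwS_gaugeDir_of_avgSeq` (`QTwS U₀ (D_{U₀}N) = D_{Ū₀}(ns_{K−n})`, row `hS`
✓`differentiableAt_logChartTwS_of_regPr`): `QTwS U₀ A = X − D_{Ū₀}(r(HX)) + D_{Ū₀}(r(HX)) = X`.

WHAT IS PROVED (ns `…Theorems.Prop7QkOntoOfRegPr`):
* §1 `four_mul_pow_le_sitesPerDir` (the no-wrap margin `4L^{K−n} ≤ |T⁽⁰⁾| = 2L^{m+K}` of M12's `H`, FREE at every member by `F.hm : 1 ≤ m`), `holT_stairWord_centre` (the recursion's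
  transporter at the centre offset is `1`).
* §2 ★★★ **`surjective_QTwS_of_regPr (hnK : n < K) (hreg : RegPr F n K ε₀ U₀) (hwin : 13·10¹⁴·L³·ε₀ ≤ 1) : Function.Surjective (QTwS F n K h U₀)`**.
* §3 ★★★ **`surjective_Qk_of_regPr … : Function.Surjective (Qk F n K h c₀ cB U₀)`** — the `onto` field of `PosOnto F n K h c₀ cB a Δx U₀` for EVERY slot `Δx`, weight `a`
  (✓`QL2_toL2`, `η ≠ 0`).
INHABITABILITY (★★OWNER RULING g27-№9 (3)): no displayed row; hypotheses = `RegPr` + `n < K` + ONE numeral `13·10¹⁴L³ε₀ ≤ 1` (M12's window; the EX display's `α L` can carry it).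
HONEST SCOPE.  No estimate (surjectivity only — the preimage's norm is `k`-dependent through the centre-supported seed and is NOT claimed); the `pos` half of `PosOnto` and `PosPrime`
([B9] Thm 3.11) are NOT touched; not a proof of any stub; nothing continuum ∕ OS ∕ mass-gap ∕ Clay.

References: T. Bałaban, CMP **99** (1985) 389–434 [Balaban1985BackgroundPropagators] ((3.14)–(3.19) p.393, (3.114)–(3.115) p.418, Thm 3.12 p.423); CMP **102** (1985) 277–309
[Balaban1985Variational] ((44)–(46) p.285); CMP **98** (1985) 17–51 [Balaban1985Averaging] ((11) p.19, (89)–(92) p.31, (97) p.32).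
-/

set_option autoImplicit false

noncomputable section

open scoped BigOperators Matrix.Norms.L2Operator Topology

namespace Summit.QuantumFields.YangMills.Theorems.Prop7QkOntoOfRegPr

open NormedSpace Filter
open Literature.MathematicalPhysics.QuantumFieldTheory.Balaban1983to89
open Literature.MathematicalPhysics.QuantumFieldTheory.Balaban1983to89.T3ContinuumYM3Torus
open T4Continuum BlockAveraging
open T3PrintedRegularMinimiser (RegPr)
open T3SectALandauChart (bgUnits eta eta_pos pos_of_regPr)
open T3LevelShift (siteShift bondShift bondShift_src bondShift_tgt fieldShift)
open T3PrintedRegularOrbits (sites_eq)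
open B10Eq27TorusAxialLog (holT holT_nil transl)
open B7Prop1Explicit (expUnit disp)
open Summit.QuantumFields.YangMills.Theorems.Prop8Chart (emlIterU)
open Summit.QuantumFields.YangMills.Theorems.Prop7SymAvgGL (descendToGL QSym descendToGL_eq_fieldShift_emlIterU)
open Summit.QuantumFields.YangMills.Theorems.Prop7SymAvgTwSym (frameTwS logChartTwS QTwS differentiableAt_logChartTwS_of_regPr)
open Summit.QuantumFields.YangMills.Theorems.Prop7SymAvgTwSymBridge (QTwS_apply_eq)
open Summit.QuantumFields.YangMills.Theorems.Prop7SymAvgTwSGaugeDir (QTwS_gaugeDir_of_avgSeq)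
open Summit.QuantumFields.YangMills.Theorems.Prop7SymFrameBound (hasFDerivAt_frameTwS_of_regPr)
open Summit.QuantumFields.YangMills.Theorems.Prop7SymAvgRelDiffT3 (hasFDerivAt_rel_of_regPr)
open Summit.QuantumFields.YangMills.Theorems.Prop7QSymCovCandidate (exists_rightInv_QSym_of_regPr)
open Summit.QuantumFields.YangMills.Theorems.Prop7CovMeanTowerOnto (exists_seed_of_covMeanTower)
open Summit.QuantumFields.BalabanUV.T4Continuum.Spine.NE7 (stairWord_zero)
open Summit.QuantumFields.YangMills.Theorems.Prop7SectET3HilbertLetters (toL2 toL2B QL2 QL2_toL2)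
open Summit.QuantumFields.YangMills.Theorems.Prop7SectET3CurvedPropagators (Qk)

variable (F : T3Family) {n K : ℕ} (h : n ≤ K)

/-! ## §1 Two bookkeeping letters -/

/-- **The no-wrap margin of M12's `H` is free at every member**: `4·L^{K−n} ≤ |T⁽⁰⁾_K| = 2·L^{m+K}` (`1 ≤ m`, `3 ≤ L`). [cite: Balaban1985UV3, (1)–(3) p.256] -/
theorem four_mul_pow_le_sitesPerDir (hle : n ≤ K) : 4 * (F.P K).L ^ (K - n) ≤ (F.P K).sitesPerDir 0 := by
  have hL3 : 3 ≤ F.L := by obtain ⟨a, ha⟩ := F.hL.1; have := F.hL.2; omega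
  have hm : 1 ≤ F.m := F.hm
  show 4 * F.L ^ (K - n) ≤ 2 * F.L ^ (F.m + K - 0)
  rw [Nat.sub_zero]
  have h1 : F.L ^ (F.m + K) = F.L ^ (F.m + n) * F.L ^ (K - n) := by rw [← pow_add]; congr 1; omega
  have h2 : 2 ≤ F.L ^ (F.m + n) := le_trans (by omega : 2 ≤ F.L) (Nat.le_self_pow (by omega) F.L)
  rw [h1]
  nlinarith [Nat.zero_le (F.L ^ (K - n))]

/-- **The recursion's transporter at the centre offset is `1`**: the staircase to the centre is empty (✓`stairWord_zero`, ✓`holT_nil`). [cite: Balaban1987RG1, (0.3) p.252] -/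
theorem holT_stairWord_centre {j : ℕ} (V : GaugeField (F.P K) j (Matrix (Fin 2) (Fin 2) ℂ)ˣ) (x : Site (F.P K) j) (i : Idx (F.P K)) (h0 : off i.1 = 0) :
    ((holT V x (stairWord i.2.1 (off i.1)) : (Matrix (Fin 2) (Fin 2) ℂ)ˣ) : Matrix (Fin 2) (Fin 2) ℂ) = 1 := by
  rw [h0, stairWord_zero, holT_nil, Units.val_one]

/-! ## §2 `QTwS U₀` is onto at a printed-regular background -/

/-- ★★★ **PRINT'S `Q(U₀) = QTwS U₀` IS ONTO AT `U₀ ∈ 𝔘_k(ε₀)`** (module docstring): preimage `H X + D_{U₀}N` with M12's `H` and a centre-supported gauge seed `N`.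
[cite: Balaban1985BackgroundPropagators, (3.19) p.393, (3.14)–(3.15) p.393, (3.115) p.418; Balaban1985Variational, (45) p.285; Balaban1985Averaging, (11) p.19, (97) p.32] -/
theorem surjective_QTwS_of_regPr (hnK : n < K) {ε₀ : ℝ} {U₀ : GaugeField (F.P K) 0 (Matrix.specialUnitaryGroup (Fin 2) ℂ)} (hreg : RegPr F n K ε₀ U₀)
    (hwin : 13 * 10 ^ 14 * (F.L : ℝ) ^ 3 * ε₀ ≤ 1) :
    Function.Surjective (QTwS F n K h U₀) := by
  intro X
  have hε₀ : 0 < ε₀ := pos_of_regPr F hreg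
  have hL1 : (1 : ℝ) ≤ F.L := by have := F.hL.2; exact_mod_cast (by omega : 1 ≤ F.L)
  have hL3 : (1 : ℝ) ≤ (F.L : ℝ) ^ 3 := one_le_pow₀ hL1
  have hx : 0 ≤ (F.L : ℝ) ^ 3 * ε₀ := by positivity
  have hε7 : 10 ^ 7 * (F.L : ℝ) ^ 3 * ε₀ ≤ 1 := by nlinarith
  have hε12 : 10 ^ 12 * (F.L : ℝ) ^ 3 * ε₀ ≤ 1 := by nlinarith
  -- M12's right inverse of the straight symmetric average
  obtain ⟨H, hH, -⟩ := exists_rightInv_QSym_of_regPr F h hnK hreg (four_mul_pow_le_sitesPerDir F h) hwin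
  -- the bridge rows and the differentiability of the re-based chart
  have hG := hasFDerivAt_rel_of_regPr F h hε₀ hε7 U₀ hreg
  have hr := hasFDerivAt_frameTwS_of_regPr F h hε₀ hε12 U₀ hreg
  have hS := differentiableAt_logChartTwS_of_regPr F h hε₀ hε12 U₀ hreg
  -- the coarse gauge datum to be reproduced: the linearised frames at `H X`, relabelled on `T^{(K)}_{K−n}`
  set ηt : Site (F.P K) (K - n) → Matrix (Fin 2) (Fin 2) ℂ := fun z =>
    fderiv ℂ (fun A : PBond (F.P K) 0 → Matrix (Fin 2) (Fin 2) ℂ =>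
      ((frameTwS F n K h U₀ A ((siteShift (sites_eq F n K h)).symm z) : (Matrix (Fin 2) (Fin 2) ℂ)ˣ) : Matrix (Fin 2) (Fin 2) ℂ)) 0 (H X) with hηtdef
  -- STEP 1: a seed whose averaging sequence (w.r.t. the recursion's own transporters) ends at `ηt`
  have hT : ∀ (j : ℕ) (y : Site (F.P K) (j + 1)) (i : Idx (F.P K)), off i.1 = 0 →
      ((holT (emlIterU j (bgUnits F K U₀)) (emb y) (stairWord i.2.1 (off i.1)) : (Matrix (Fin 2) (Fin 2) ℂ)ˣ) : Matrix (Fin 2) (Fin 2) ℂ) = 1 :=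
    fun j y i h0 => holT_stairWord_centre F _ _ i h0
  have hk : K - n ≤ (F.P K).m + (F.P K).K := by show K - n ≤ F.m + K; omega
  obtain ⟨N, ns, h0, hs, hkN⟩ := exists_seed_of_covMeanTower (P := F.P K) (𝔸 := Matrix (Fin 2) (Fin 2) ℂ)
    (fun j y i => holT (emlIterU j (bgUnits F K U₀)) (emb y) (stairWord i.2.1 (off i.1))) hT (K - n) hk ηt
  -- the gauge direction of `N` is read by `QTwS` as the coarse gauge direction of `ns (K − n) = ηt`
  have hgauge := QTwS_gaugeDir_of_avgSeq F h U₀ hS N ns h0 hs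
  rw [hkN] at hgauge
  -- the preimage `H X + D_{U₀}N`
  refine ⟨H X + (fun b : PBond (F.P K) 0 => N b.src - ((bgUnits F K U₀ b : (Matrix (Fin 2) (Fin 2) ℂ)ˣ) : Matrix (Fin 2) (Fin 2) ℂ) * N b.tgt
      * (((bgUnits F K U₀ b)⁻¹ : (Matrix (Fin 2) (Fin 2) ℂ)ˣ) : Matrix (Fin 2) (Fin 2) ℂ)), ?_⟩
  rw [map_add, hgauge]
  funext c
  have hD : descendToGL F n K h (bgUnits F K U₀) c = emlIterU (K - n) (bgUnits F K U₀) (bondShift (sites_eq F n K h) c) := by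
    rw [descendToGL_eq_fieldShift_emlIterU]; rfl
  have hsrc : ηt (bondShift (sites_eq F n K h) c).src
      = fderiv ℂ (fun A : PBond (F.P K) 0 → Matrix (Fin 2) (Fin 2) ℂ => ((frameTwS F n K h U₀ A c.src : (Matrix (Fin 2) (Fin 2) ℂ)ˣ) : Matrix (Fin 2) (Fin 2) ℂ)) 0 (H X) := by
    simp only [hηtdef, bondShift_src, Equiv.symm_apply_apply]
  have htgt : ηt (bondShift (sites_eq F n K h) c).tgt
      = fderiv ℂ (fun A : PBond (F.P K) 0 → Matrix (Fin 2) (Fin 2) ℂ => ((frameTwS F n K h U₀ A c.tgt : (Matrix (Fin 2) (Fin 2) ℂ)ˣ) : Matrix (Fin 2) (Fin 2) ℂ)) 0 (H X) := by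
    simp only [hηtdef, bondShift_tgt, Equiv.symm_apply_apply]
    rfl
  rw [Pi.add_apply, QTwS_apply_eq F h U₀ hG hr (H X) c, hH X, hD, hsrc, htgt]
  exact sub_add_cancel _ _

/-! ## §3 `Q_k(U₀)` is onto at a printed-regular background — the `onto` field of `PosOnto` -/

/-- ★★★ **`Q_k(U₀) = η • toL2B ∘ Q(U₀) ∘ toL2⁻¹` IS ONTO AT `U₀ ∈ 𝔘_k(ε₀)`** — the `onto` half of the EX display's class row `hN06` (`PosOnto …(Δ_π) U₀`), for every Hessian slot and weight.
[cite: Balaban1985BackgroundPropagators, (3.19) p.393, (3.122)–(3.126) p.420; Balaban1985Variational, (44)–(45) p.285] -/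
theorem surjective_Qk_of_regPr (hnK : n < K) (c₀ cB : ℝ) {ε₀ : ℝ}
    {U₀ : GaugeField (F.P K) 0 (Matrix.specialUnitaryGroup (Fin 2) ℂ)} (hreg : RegPr F n K ε₀ U₀) (hwin : 13 * 10 ^ 14 * (F.L : ℝ) ^ 3 * ε₀ ≤ 1) :
    Function.Surjective (Qk F n K h c₀ cB U₀) := by
  intro w
  have hη : (((eta F n K : ℝ)) : ℂ) ≠ 0 := Complex.ofReal_ne_zero.mpr (eta_pos F n K).ne'
  obtain ⟨A, hA⟩ := surjective_QTwS_of_regPr F h hnK hreg hwin ((((eta F n K : ℝ)) : ℂ)⁻¹ • (toL2B F n cB).symm w)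
  refine ⟨toL2 F K c₀ A, ?_⟩
  show ((((eta F n K : ℝ)) : ℂ) • QL2 F n K h c₀ cB U₀) (toL2 F K c₀ A) = w
  rw [LinearMap.smul_apply, QL2_toL2, hA, map_smul, LinearEquiv.apply_symm_apply, smul_smul, mul_inv_cancel₀ hη, one_smul]

end Summit.QuantumFields.YangMills.Theorems.Prop7QkOntoOfRegPr

end
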